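import Mathlib
import Literature.Geometry.DiscreteGeometry.TwoShellChartSemantics
import Summits.AtomisticToContinuum.Crystallization.Theorems.NashClassCertificatesNashNearFieldStubLabelledPlacementPlace

/-!
# Crux `NashClassCertificates.NashNearField` (stmt-AtomisticToContinuum-16827), line `birth`,
# stub `stub_labelledPlacement` — soundness III: ELIMINATIONS are contradictions

`robustInside e q`: the particle bounded by the entry `e` lies within `141/100 ≤ 3ρ_q/2` of the particle of the pivot `q`
and is not that particle, hence is one of `q`'s pattern particles (completeness of `q`).  `differs e e'`: two entries
bounding the same particle cannot predict points farther apart than the sum of their errors.  Consequently an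
elimination of type A (an entry of the current pivot against the table describing an assigned pivot) or of type B (an
entry of an assigned pivot against all placements of the current pivot) refutes the data.  Also: the checker's table
permutation test is sound (`tablePerm_perm`), and descriptions transport along permutations.
-/

noncomputable section

open Literature.Geometry.DiscreteGeometry Literature.Geometry.DiscreteGeometry.TwoShellCheck
  Literature.Geometry.DiscreteGeometry.TwoShellChart

namespace Summit.AtomisticToContinuum.Crystallization.Theorems.NashClassCertificatesNashNearField

variable {ι : Type*} {cen : List IVec} {pos : ι → EuclideanSpace ℝ (Fin 3)} {i₀ : ι} {fC : IVec → ι}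

/-! ### Real readings of the integer inequalities -/

/-- The placed point of an entry relative to a model point: `P/d − pt q = d⁻¹ • pt (P − d q)`. -/
theorem entryPoint_sub_pt {P q : IVec} {d : ℤ} (hd : d ≠ 0) :
    ((d : ℝ))⁻¹ • pt P - pt q = ((d : ℝ))⁻¹ • pt (vsub P (vsmul d q)) := by
  have hd' : (d : ℝ) ≠ 0 := by exact_mod_cast hd
  rw [pt_vsub, pt_vsmul, smul_sub, smul_smul, inv_mul_cancel₀ hd', one_smul]

/-- `‖d⁻¹ • pt z‖² = sq z / (18 d²)`. -/
theorem norm_inv_smul_pt_sq {z : IVec} {d : ℤ} (hd : d ≠ 0) :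
    ‖((d : ℝ))⁻¹ • pt z‖ ^ 2 = (TwoShellCheck.sq z : ℝ) / (18 * (d : ℝ) ^ 2) := by
  rw [norm_smul, mul_pow, norm_inv, inv_pow, Real.norm_eq_abs, sq_abs, norm_pt_sq]
  have hd' : (d : ℝ) ≠ 0 := by exact_mod_cast hd
  field_simp

/-- If `x² · c² ≤ y²` with `x, y ≥ 0`, `c > 0` then `x · c ≤ y`. -/
theorem mul_le_of_sq_mul_sq_le {x y c : ℝ} (hx : 0 ≤ x) (hy : 0 ≤ y) (hc : 0 < c) (h : x ^ 2 * c ^ 2 ≤ y ^ 2) :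
    x * c ≤ y := by
  have : (x * c) ^ 2 ≤ y ^ 2 := by rw [mul_pow]; exact h
  exact (pow_le_pow_iff_left₀ (by positivity) hy two_ne_zero).1 this

/-- If `y² < x² · c²` with `x ≥ 0`, `c > 0` then `y < x · c`. -/
theorem lt_mul_of_sq_lt_sq_mul {x y c : ℝ} (hx : 0 ≤ x) (hc : 0 < c) (h : y ^ 2 < x ^ 2 * c ^ 2) :
    y < x * c := by
  have : y ^ 2 < (x * c) ^ 2 := by rw [mul_pow]; exact h
  exact lt_of_pow_lt_pow_left₀ 2 (by positivity) this

/-- **`robustInside` read in the reals**: with `E = num/(940|d|)` and `D = ‖P/d − pt q‖`: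
`D + E ≤ 136/100` and `E + 1/20 < D`. -/
theorem robustInside_real {e : Entry} {q : IVec} (h : robustInside e q = true) (hd : e.2.1 ≠ 0) :
    ‖((e.2.1 : ℝ))⁻¹ • pt e.1 - pt q‖ + (e.2.2 : ℝ) / (940 * |(e.2.1 : ℝ)|) ≤ 136 / 100 ∧
    (e.2.2 : ℝ) / (940 * |(e.2.1 : ℝ)|) + 1 / 20 < ‖((e.2.1 : ℝ))⁻¹ • pt e.1 - pt q‖ := by
  obtain ⟨P, d, num⟩ := e
  simp only at hd ⊢
  unfold robustInside at h
  simp only [Bool.and_eq_true, decide_eq_true_eq] at h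
  obtain ⟨⟨hr0, h1⟩, h2⟩ := h
  have hdR : (d : ℝ) ≠ 0 := by exact_mod_cast hd
  have hdpos : 0 < |(d : ℝ)| := abs_pos.2 hdR
  set D := ‖((d : ℝ))⁻¹ • pt P - pt q‖ with hD
  have hDsq : D ^ 2 = (TwoShellCheck.sq (vsub P (vsmul d q)) : ℝ) / (18 * (d : ℝ) ^ 2) := by
    rw [hD, entryPoint_sub_pt hd, norm_inv_smul_pt_sq hd]
  have hD0 : 0 ≤ D := norm_nonneg _
  -- cast the integer inequalities
  have hr0' : (0 : ℝ) ≤ 12784 * |(d : ℝ)| - 10 * num := by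
    have := hr0; rw [← cast_zabs]; exact_mod_cast this
  have h1' : (TwoShellCheck.sq (vsub P (vsmul d q)) : ℝ) * (9400 * 9400) ≤
      18 * ((12784 * |(d : ℝ)| - 10 * num) * (12784 * |(d : ℝ)| - 10 * num)) := by
    rw [← cast_zabs]; exact_mod_cast h1
  have h2' : (TwoShellCheck.sq (vsub P (vsmul d q)) : ℝ) * (940 * 940) >
      18 * ((num + 47 * |(d : ℝ)|) * (num + 47 * |(d : ℝ)|)) := by
    rw [← cast_zabs]; exact_mod_cast h2
  have hsq : (TwoShellCheck.sq (vsub P (vsmul d q)) : ℝ) = D ^ 2 * (18 * (d : ℝ) ^ 2) := by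
    rw [hDsq]; field_simp
  have hd2 : (d : ℝ) ^ 2 = |(d : ℝ)| ^ 2 := (sq_abs _).symm
  constructor
  · -- D ≤ (12784|d| - 10 num)/(9400 |d|)
    have key : D * (9400 * |(d : ℝ)|) ≤ 12784 * |(d : ℝ)| - 10 * num := by
      apply mul_le_of_sq_mul_sq_le hD0 hr0' (by positivity)
      rw [hsq, hd2] at h1'
      nlinarith
    have e1 : (num : ℝ) / (940 * |(d : ℝ)|) = (10 * num) / (9400 * |(d : ℝ)|) := by
      field_simp; ring
    rw [e1, ← le_sub_iff_add_le', div_le_iff₀ (by positivity)]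
    nlinarith
  · have key : num + 47 * |(d : ℝ)| < D * (940 * |(d : ℝ)|) := by
      apply lt_mul_of_sq_lt_sq_mul hD0 (by positivity)
      rw [hsq, hd2] at h2'
      nlinarith
    have e1 : (num : ℝ) / (940 * |(d : ℝ)|) + 1 / 20 = (num + 47 * |(d : ℝ)|) / (940 * |(d : ℝ)|) := by
      field_simp; ring
    rw [e1, div_lt_iff₀ (by positivity)]
    linarith

/-- **The particle of a robust-inside entry is a pattern particle of the pivot `q`.** -/
theorem particle_of_robustInside (hC : CentreGood cen pos i₀ fC) {q : IVec} (hq : q ∈ cen) {Wq : PivotW ι}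
    (hWq : PivotGood pos (fC q) Wq) {k : ι} {e : Entry} (hb : EntryBound (pos k) e) (h : robustInside e q = true) :
    ∃ w' ∈ modelList Wq.t, Wq.fP w' = k := by
  obtain ⟨hd, hbd⟩ := hb
  obtain ⟨hin, hfar⟩ := robustInside_real h hd
  have hq20 := (hC.2.1 q hq).2
  obtain ⟨-, hρ1, -, -, -, hcomp⟩ := hWq
  refine hcomp k ?_ ?_
  · intro hk
    rw [hk] at hbd
    have : ‖((e.2.1 : ℝ))⁻¹ • pt e.1 - pt q‖ ≤ (e.2.2 : ℝ) / (940 * |(e.2.1 : ℝ)|) + 1 / 20 :=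
      calc ‖((e.2.1 : ℝ))⁻¹ • pt e.1 - pt q‖
          = ‖(pos (fC q) - pt q) - (pos (fC q) - ((e.2.1 : ℝ))⁻¹ • pt e.1)‖ := by congr 1; abel
        _ ≤ ‖pos (fC q) - pt q‖ + ‖pos (fC q) - ((e.2.1 : ℝ))⁻¹ • pt e.1‖ := norm_sub_le _ _
        _ ≤ 1 / 20 + (e.2.2 : ℝ) / (940 * |(e.2.1 : ℝ)|) := add_le_add hq20 hbd
        _ = _ := add_comm _ _
    linarith
  · calc ‖pos k - pos (fC q)‖
        = ‖(pos k - ((e.2.1 : ℝ))⁻¹ • pt e.1) + (((e.2.1 : ℝ))⁻¹ • pt e.1 - pt q) - (pos (fC q) - pt q)‖ := by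
          congr 1; abel
      _ ≤ ‖pos k - ((e.2.1 : ℝ))⁻¹ • pt e.1‖ + ‖((e.2.1 : ℝ))⁻¹ • pt e.1 - pt q‖ + ‖pos (fC q) - pt q‖ := by
          refine (norm_sub_le _ _).trans ?_
          gcongr
          exact norm_add_le _ _
      _ ≤ 136 / 100 + 1 / 20 := by linarith
      _ ≤ 3 / 2 * Wq.ρ := by linarith

/-- **`differs` is a contradiction for two entries bounding the same point.** -/
theorem differs_false {y : EuclideanSpace ℝ (Fin 3)} {e e' : Entry} (hb : EntryBound y e) (hb' : EntryBound y e')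
    (h : differs e e' = true) : False := by
  obtain ⟨P, d, num⟩ := e
  obtain ⟨P', d', num'⟩ := e'
  obtain ⟨hd, hbd⟩ := hb
  obtain ⟨hd', hbd'⟩ := hb'
  simp only at hd hd' hbd hbd'
  unfold differs at h
  simp only [decide_eq_true_eq] at h
  have hdR : (d : ℝ) ≠ 0 := by exact_mod_cast hd
  have hdR' : (d' : ℝ) ≠ 0 := by exact_mod_cast hd'
  -- the distance of the two placed points
  set Q := ((d : ℝ))⁻¹ • pt P - ((d' : ℝ))⁻¹ • pt P' with hQ
  have hQeq : Q = ((d : ℝ) * d')⁻¹ • pt (vsub (vsmul d' P) (vsmul d P')) := by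
    rw [hQ, pt_vsub, pt_vsmul, pt_vsmul, smul_sub, smul_smul, smul_smul, mul_inv]
    congr 1
    · rw [show (d : ℝ)⁻¹ * (d' : ℝ)⁻¹ * d' = (d : ℝ)⁻¹ by field_simp]
    · rw [show (d : ℝ)⁻¹ * (d' : ℝ)⁻¹ * d = (d' : ℝ)⁻¹ by field_simp]
  have hQsq : ‖Q‖ ^ 2 = (TwoShellCheck.sq (vsub (vsmul d' P) (vsmul d P')) : ℝ) / (18 * ((d : ℝ) * d') ^ 2) := by
    rw [hQeq, norm_smul, mul_pow, norm_inv, inv_pow, Real.norm_eq_abs, sq_abs, norm_pt_sq]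
    field_simp
  have hQle : ‖Q‖ ≤ num / (940 * |(d : ℝ)|) + num' / (940 * |(d' : ℝ)|) := by
    calc ‖Q‖ = ‖(y - ((d' : ℝ))⁻¹ • pt P') - (y - ((d : ℝ))⁻¹ • pt P)‖ := by rw [hQ]; congr 1; abel
      _ ≤ ‖y - ((d' : ℝ))⁻¹ • pt P'‖ + ‖y - ((d : ℝ))⁻¹ • pt P‖ := norm_sub_le _ _
      _ ≤ _ := by linarith
  have h' : (TwoShellCheck.sq (vsub (vsmul d' P) (vsmul d P')) : ℝ) * (940 * 940) >
      18 * ((num * |(d' : ℝ)| + num' * |(d : ℝ)|) * (num * |(d' : ℝ)| + num' * |(d : ℝ)|)) := by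
    rw [← cast_zabs d', ← cast_zabs d]
    exact_mod_cast h
  have hpos : 0 < |(d : ℝ)| := abs_pos.2 hdR
  have hpos' : 0 < |(d' : ℝ)| := abs_pos.2 hdR'
  have hprod : ((d : ℝ) * d') ^ 2 = |(d : ℝ)| ^ 2 * |(d' : ℝ)| ^ 2 := by rw [mul_pow, sq_abs, sq_abs]
  have hsq : (TwoShellCheck.sq (vsub (vsmul d' P) (vsmul d P')) : ℝ) = ‖Q‖ ^ 2 * (18 * (|(d : ℝ)| ^ 2 * |(d' : ℝ)| ^ 2)) := by
    rw [hQsq, hprod]; field_simp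
  -- `‖Q‖ · 940 |d||d'| ≤ num|d'| + num'|d|`
  have hQle' : ‖Q‖ * (940 * |(d : ℝ)| * |(d' : ℝ)|) ≤ num * |(d' : ℝ)| + num' * |(d : ℝ)| := by
    have := hQle
    rw [div_add_div _ _ (by positivity) (by positivity), le_div_iff₀ (by positivity)] at this
    nlinarith
  have hb0 : 0 ≤ ‖Q‖ * (940 * |(d : ℝ)| * |(d' : ℝ)|) := by positivity
  have hsqle := mul_self_le_mul_self hb0 hQle'
  rw [hsq] at h'
  have e : ‖Q‖ ^ 2 * (18 * (|(d : ℝ)| ^ 2 * |(d' : ℝ)| ^ 2)) * (940 * 940) =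
      18 * ((‖Q‖ * (940 * |(d : ℝ)| * |(d' : ℝ)|)) * (‖Q‖ * (940 * |(d : ℝ)| * |(d' : ℝ)|))) := by ring
  rw [e] at h'
  linarith

/-! ### Eliminations -/

/-- Membership in a described table: every label's entry is in the table, and every table entry is some label's. -/
theorem tableDescribes_mem_iff {W : PivotW ι} {T : List Entry} (hT : TableDescribes pos W T) :
    ∃ eo : IVec → Entry, (∀ w ∈ modelList W.t, eo w ∈ T ∧ EntryBound (pos (W.fP w)) (eo w)) ∧
      ∀ e ∈ T, ∃ w ∈ modelList W.t, eo w = e := by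
  obtain ⟨eo, hperm, hb⟩ := hT
  refine ⟨eo, fun w hw => ⟨hperm.mem_iff.1 (List.mem_map_of_mem hw), hb w hw⟩, fun e he => ?_⟩
  obtain ⟨w, hw, h⟩ := List.mem_map.1 (hperm.mem_iff.2 he)
  exact ⟨w, hw, h⟩

/-- **Elimination of type A refutes the data.** -/
theorem elimA_false (hC : CentreGood cen pos i₀ fC) {q : IVec} (hq : q ∈ cen) {Wq : PivotW ι}
    (hWq : PivotGood pos (fC q) Wq) {T : List Entry} (hT : TableDescribes pos Wq T)
    {k : ι} {e : Entry} (hb : EntryBound (pos k) e) (h : elimA e q T = true) : False := by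
  unfold elimA at h
  rw [Bool.and_eq_true, List.all_eq_true] at h
  obtain ⟨hri, hall⟩ := h
  obtain ⟨w', hw', hk⟩ := particle_of_robustInside hC hq hWq hb hri
  obtain ⟨eo, hmem, -⟩ := tableDescribes_mem_iff hT
  obtain ⟨hin, hb'⟩ := hmem w' hw'
  rw [hk] at hb'
  exact differs_false hb hb' (hall _ hin)

/-- **Elimination of type B refutes the data**: an entry of the table describing the assigned pivot `q`, robustly
inside the current pivot `p`'s ball, differing from correct placements of all labels of `p`. -/
theorem elimB_false (hC : CentreGood cen pos i₀ fC) {p : IVec} (hp : p ∈ cen)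
    {Wp Wq : PivotW ι} (hWp : PivotGood pos (fC p) Wp)
    {T : List Entry} (hT : TableDescribes pos Wq T) {e : Entry} (he : e ∈ T) (hri : robustInside e p = true)
    {cs phi : List IVec} (hcs : ∀ c ∈ cs, c ∈ commonsOf cen p) (hL : LabelsOK i₀ fC Wp cs phi)
    {trs : List (ℕ × ℕ × ℕ)} (hlen : trs.length = (modelList Wp.t).length)
    (hall : (List.zip (modelList Wp.t) trs).all (fun wt =>
      match placeLabel cs phi p wt.2 wt.1 with
      | some ep => differs e ep
      | none => false) = true) : False := by
  obtain ⟨eo, hmem, hsurj⟩ := tableDescribes_mem_iff hT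
  obtain ⟨w', hw', rfl⟩ := hsurj e he
  obtain ⟨-, hb'⟩ := hmem w' hw'
  -- the particle of `w'` is a pattern particle of `p`
  obtain ⟨w'', hw'', hk⟩ := particle_of_robustInside hC hp hWp hb' hri
  obtain ⟨i, hi, rfl⟩ := List.mem_iff_getElem.1 hw''
  rw [List.all_eq_true] at hall
  have hi' : i < trs.length := by omega
  have hzip : ((modelList Wp.t)[i], trs[i]) ∈ List.zip (modelList Wp.t) trs := by
    rw [List.mem_iff_getElem]
    exact ⟨i, by rw [List.length_zip]; exact lt_min hi hi', by rw [List.getElem_zip]⟩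
  have := hall _ hzip
  simp only at this
  cases hpl : placeLabel cs phi p trs[i] (modelList Wp.t)[i] with
  | none => rw [hpl] at this; exact absurd this (by simp)
  | some ep =>
    rw [hpl] at this
    have hbp := placeLabel_sound hC hp hWp hcs hL (List.getElem_mem hi) hpl
    rw [hk] at hbp
    exact differs_false hb' hbp this

/-! ### The table permutation test -/

/-- `entryEq` is equality. -/
theorem entryEq_iff (e e' : Entry) : entryEq e e' = true ↔ e = e' := by
  obtain ⟨⟨a, b, c⟩, d, n⟩ := e
  obtain ⟨⟨a', b', c'⟩, d', n'⟩ := e'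
  simp [entryEq, veq, Prod.ext_iff]
  tauto

/-- `tableErase e T = some T'` means `e ∈ T` and `T ~ e :: T'`. -/
theorem tableErase_perm {e : Entry} : ∀ {T T' : List Entry}, tableErase e T = some T' → List.Perm T (e :: T')
  | [], T', h => by simp [tableErase] at h
  | e' :: T, T', h => by
    unfold tableErase at h
    split_ifs at h with heq
    · simp only [Option.some.injEq] at h
      subst h
      rw [(entryEq_iff e e').1 heq]
    · cases h' : tableErase e T with
      | none => rw [h'] at h; simp at h
      | some T'' =>
        rw [h'] at h
        simp only [Option.map_some, Option.some.injEq] at h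
        subst h
        exact ((tableErase_perm h').cons e').trans (List.Perm.swap e e' T'')

/-- **Soundness of `tablePerm`.** -/
theorem tablePerm_perm : ∀ {T T' : List Entry}, tablePerm T T' = true → List.Perm T T'
  | [], [], _ => List.Perm.refl _
  | [], _ :: _, h => by simp [tablePerm] at h
  | e :: T, T', h => by
    unfold tablePerm at h
    cases h' : tableErase e T' with
    | none => rw [h'] at h; simp at h
    | some T'' =>
      rw [h'] at h
      exact ((tablePerm_perm h).cons e).trans (tableErase_perm h').symm

/-- Descriptions transport along permutations of the table. -/
theorem tableDescribes_of_perm {W : PivotW ι} {T T' : List Entry} (hT : TableDescribes pos W T)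
    (h : List.Perm T T') : TableDescribes pos W T' := by
  obtain ⟨eo, hperm, hb⟩ := hT
  exact ⟨eo, hperm.trans h, hb⟩

/-- **Registered sub-goal `stub_labelledPlacementTablePerm` of crux stmt-AtomisticToContinuum-16827** (landing anchor of this file,
re-exporting `tablePerm_perm`). -/
theorem stub_labelledPlacementTablePerm : ∀ (T T' : List Literature.Geometry.DiscreteGeometry.TwoShellChart.Entry), Literature.Geometry.DiscreteGeometry.TwoShellChart.tablePerm T T' = true → List.Perm T T' :=
  fun _ _ h => tablePerm_perm h

end Summit.AtomisticToContinuum.Crystallization.Theorems.NashClassCertificatesNashNearField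

end
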